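import Summits.ResolutionOfSingularities.ResolutionOfSingularities.Theorems.MarkedTransferCampaignW13RFlatCanonicalPosSurfaceAllP
import HarnessLib

/-!
# [OURS · L1 W1.3] Surfaces, every characteristic (part 3): the order-`p` locus of `g_p` is THE ORIGIN ALONE — the uniform
# surface witness fails at an ISOLATED point of `Sing(Ě)`, `Ě = ((g_p), p)` (seat res-L1-s13-pv-1, g3)

LADDER-RESOLUTION rung L (rescue), cell `res-hironaka`, RESCUE-SEED slot W1.3 (architecture bypass, reading R-flat), F7′ row 1.
Companion to p514228 / p515380 (`MarkedTransferCampaignW13RFlatCanonicalPosSurfaceAllP{Arc,}.lean`): for the family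
`g_p = u^p + (x³L^{p−2})^p + L^{p−1}(L^p + x^{2p+1})^{p−1}`, `L = y − x`, `p = k+2`, over ANY field `K` of characteristic `p`,
the order-`≥ p` locus `top(g_p, p) = {P : g_p(P + v) ∈ (v)^p}` (Taylor form, as in p506602 `aeval_hasseDeriv_eq_zero_of_mem_pow`
and p503083 `S_mem_orderTwoLocus_iff`) is EXACTLY the origin (`surfAllP_topLocus_iff`). So, uniformly in `p`, the R-flat rung-1
failure of p515380 happens at an isolated point of `Sing(Ě)` and is invisible to the top locus — it is detected only by an arc
tangent to the hypersurface to high order (p514228). Mechanism (`P = (a, b, c)`, `λ = b − a`, `F(P) = λ^p + a^{2p+1}`):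
restricting `g_p(P + v)` to the line `v = (0, t, 0)` leaves, modulo `t^p`, the polynomial
`c^p + a^{3p}λ^{p(p−2)} + F(P)^{p−1}(t + λ)^{p−1}` of degree `< p`, whence `F(P) = 0` and `c^p + a^{3p}λ^{p(p−2)} = 0`
(`surfAllP_top_step1`); restricting to `v = (t, t, 0)` (so `L` stays `λ`) then leaves `λ^{p−1}a^{2p(p−1)}·t^{p−1}`, whence
`λ = 0 ∨ a = 0`, and with `F(P) = 0` both vanish, then `c = 0` (`surfAllP_topLocus`). Generic tool: a `K`-algebra map
`K[v] → K[t]` sending every `v_i` into `(t)` maps `(v)^b` into `(t^b)` (`X_pow_dvd_of_mem_pow_idealOfVars`).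

HONEST FRAMING. OURS statements about the OURS bypass objects; nothing here is a statement of H. Hironaka's manuscript [Hironaka2017]
(2017-03-23, lit key `paper:url-3343fd9e678b`); no claim about resolution of singularities in positive characteristic; AI
bookkeeping weaker than expert review. Caveat of record: nothing here bears on L-G4 / (127). All decls `[folklore]`, sorry-free.
-/

noncomputable section

set_option linter.dupNamespace false -- mandated namespace of this single-conjunct summit

namespace Summit.ResolutionOfSingularities.ResolutionOfSingularities.Theorems.Campaign.W13

open MvPolynomial

/-! ## §1 Generic: substitutions into `K[t]` along lines through the origin -/

section Generic

variable (K : Type) [Field K]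

/-- A `K`-algebra map `φ : K[v_σ] → K[t]` with `t ∣ φ(v_i)` for all `i` sends `(v)^b` into `(t^b)`. [folklore] -/
theorem X_pow_dvd_of_mem_pow_idealOfVars {σ : Type} (φ : MvPolynomial σ K →ₐ[K] Polynomial K)
    (hφ : ∀ i, Polynomial.X ∣ φ (X i)) (b : ℕ) {G : MvPolynomial σ K} (hG : G ∈ idealOfVars σ K ^ b) :
    Polynomial.X ^ b ∣ φ G := by
  have hle : (idealOfVars σ K).map φ ≤ Ideal.span {Polynomial.X} := by
    rw [Ideal.map_span]
    refine Ideal.span_le.mpr ?_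
    rintro _ ⟨_, ⟨i, rfl⟩, rfl⟩
    exact Ideal.mem_span_singleton.mpr (hφ i)
  have h1 : φ G ∈ (Ideal.span {Polynomial.X} : Ideal (Polynomial K)) ^ b := by
    have h := Ideal.mem_map_of_mem φ hG
    rw [Ideal.map_pow] at h
    exact Ideal.pow_right_mono hle b h
  rwa [Ideal.span_singleton_pow, Ideal.mem_span_singleton] at h1

/-- A polynomial `C e₀ + C e₁·(X + C λ)^{n+1}` divisible by `X^{n+2}` has `e₁ = 0` and `e₀ = 0` (degree `< n+2`). [folklore] -/
theorem eq_zero_of_X_pow_dvd_affine_pow (e₀ e₁ lam : K) (n : ℕ)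
    (h : (Polynomial.X : Polynomial K) ^ (n + 2) ∣
      Polynomial.C e₀ + Polynomial.C e₁ * (Polynomial.X + Polynomial.C lam) ^ (n + 1)) : e₁ = 0 ∧ e₀ = 0 := by
  rw [Polynomial.X_pow_dvd_iff] at h
  have hn := h (n + 1) (Nat.lt_succ_self _)
  rw [Polynomial.coeff_add, Polynomial.coeff_C_mul, Polynomial.coeff_X_add_C_pow, Nat.sub_self, pow_zero, one_mul,
    Nat.choose_self, Nat.cast_one, mul_one, Polynomial.coeff_C, if_neg (Nat.succ_ne_zero n), zero_add] at hn
  refine ⟨hn, ?_⟩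
  have h0 := h 0 (Nat.succ_pos _)
  rw [hn, map_zero, zero_mul, add_zero, Polynomial.coeff_C_zero] at h0
  exact h0

end Generic

/-! ## §2 The order-`p` locus of `g_p` -/

section Top

variable (K : Type) [Field K] (k : ℕ) [hp : Fact (k + 2).Prime] [CharP K (k + 2)]

/-- **Step 1** (the line `v = (0,t,0)`): if `P = (a,b,c)` lies in the order-`≥ p` locus of `g_p` then `F(P) = λ^p + a^{2p+1} = 0`
and `c^p + a^{3p}λ^{p(p−2)} = 0`, `λ = b − a`. [folklore] -/
theorem surfAllP_top_step1 (a b c : K)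
    (h : MvPolynomial.aeval (fun i => C ((![a, b, c] : Fin 3 → K) i) + X i)
      (X 2 ^ (k + 2) + ((X 0 ^ 3 * (X 1 - X 0) ^ k) ^ (k + 2) +
        (X 1 - X 0) ^ (k + 1) * ((X 1 - X 0) ^ (k + 2) + X 0 ^ (2 * k + 5)) ^ (k + 1)) : MvPolynomial (Fin 3) K) ∈
        idealOfVars (Fin 3) K ^ (k + 2)) :
    (b - a) ^ (k + 2) + a ^ (2 * k + 5) = 0 ∧ c ^ (k + 2) + a ^ (3 * (k + 2)) * (b - a) ^ ((k + 2) * k) = 0 := by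
  classical
  -- the substitution `v ↦ (0, t, 0)`
  have hφ : ∀ i, Polynomial.X ∣ (MvPolynomial.aeval ![(0 : Polynomial K), Polynomial.X, 0]) (X i : MvPolynomial (Fin 3) K) := by
    intro i
    fin_cases i
    · exact ⟨0, by simp⟩
    · exact ⟨1, by simp⟩
    · exact ⟨0, by simp⟩
  have hdiv := X_pow_dvd_of_mem_pow_idealOfVars K _ hφ (k + 2) h
  have hcomp : (MvPolynomial.aeval ![(0 : Polynomial K), Polynomial.X, 0]) (MvPolynomial.aeval
      (fun i => C ((![a, b, c] : Fin 3 → K) i) + X i)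
      (X 2 ^ (k + 2) + ((X 0 ^ 3 * (X 1 - X 0) ^ k) ^ (k + 2) +
        (X 1 - X 0) ^ (k + 1) * ((X 1 - X 0) ^ (k + 2) + X 0 ^ (2 * k + 5)) ^ (k + 1)) : MvPolynomial (Fin 3) K)) =
      Polynomial.C c ^ (k + 2) + ((Polynomial.C a ^ 3 * (Polynomial.X + Polynomial.C (b - a)) ^ k) ^ (k + 2) +
        (Polynomial.X + Polynomial.C (b - a)) ^ (k + 1) *
          ((Polynomial.X + Polynomial.C (b - a)) ^ (k + 2) + Polynomial.C a ^ (2 * k + 5)) ^ (k + 1)) := by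
    rw [MvPolynomial.comp_aeval_apply]
    simp only [map_add, map_sub, map_mul, map_pow, MvPolynomial.aeval_X, MvPolynomial.aeval_C,
      Polynomial.algebraMap_eq, Matrix.cons_val_zero, Matrix.cons_val_one, Matrix.cons_val_two, Matrix.tail_cons,
      Matrix.head_cons]
    ring
  rw [hcomp] at hdiv
  -- the remainder modulo `t^p`
  have hF : (Polynomial.X + Polynomial.C (b - a)) ^ (k + 2) = Polynomial.X ^ (k + 2) + Polynomial.C (b - a) ^ (k + 2) :=
    add_pow_char _ _ (k + 2)
  have d1 : (Polynomial.X : Polynomial K) ^ (k + 2) ∣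
      ((Polynomial.X + Polynomial.C (b - a)) ^ k) ^ (k + 2) - Polynomial.C (b - a) ^ ((k + 2) * k) := by
    rw [← pow_mul, mul_comm k (k + 2), pow_mul (Polynomial.X + Polynomial.C (b - a)), hF, pow_mul]
    refine dvd_trans ?_ (sub_dvd_pow_sub_pow _ _ k)
    exact Dvd.intro 1 (by ring)
  have d2 : (Polynomial.X : Polynomial K) ^ (k + 2) ∣
      ((Polynomial.X + Polynomial.C (b - a)) ^ (k + 2) + Polynomial.C a ^ (2 * k + 5)) ^ (k + 1) -
        (Polynomial.C (b - a) ^ (k + 2) + Polynomial.C a ^ (2 * k + 5)) ^ (k + 1) := by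
    rw [hF]
    refine dvd_trans ?_ (sub_dvd_pow_sub_pow _ _ (k + 1))
    exact Dvd.intro 1 (by ring)
  have hr : (Polynomial.X : Polynomial K) ^ (k + 2) ∣
      Polynomial.C (c ^ (k + 2) + a ^ (3 * (k + 2)) * (b - a) ^ ((k + 2) * k)) +
        Polynomial.C (((b - a) ^ (k + 2) + a ^ (2 * k + 5)) ^ (k + 1)) * (Polynomial.X + Polynomial.C (b - a)) ^ (k + 1) := by
    have e : Polynomial.C (c ^ (k + 2) + a ^ (3 * (k + 2)) * (b - a) ^ ((k + 2) * k)) +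
        Polynomial.C (((b - a) ^ (k + 2) + a ^ (2 * k + 5)) ^ (k + 1)) * (Polynomial.X + Polynomial.C (b - a)) ^ (k + 1) =
        (Polynomial.C c ^ (k + 2) + ((Polynomial.C a ^ 3 * (Polynomial.X + Polynomial.C (b - a)) ^ k) ^ (k + 2) +
          (Polynomial.X + Polynomial.C (b - a)) ^ (k + 1) *
            ((Polynomial.X + Polynomial.C (b - a)) ^ (k + 2) + Polynomial.C a ^ (2 * k + 5)) ^ (k + 1))) -
        (Polynomial.C a ^ (3 * (k + 2)) *
            (((Polynomial.X + Polynomial.C (b - a)) ^ k) ^ (k + 2) - Polynomial.C (b - a) ^ ((k + 2) * k)) +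
          (Polynomial.X + Polynomial.C (b - a)) ^ (k + 1) *
            (((Polynomial.X + Polynomial.C (b - a)) ^ (k + 2) + Polynomial.C a ^ (2 * k + 5)) ^ (k + 1) -
              (Polynomial.C (b - a) ^ (k + 2) + Polynomial.C a ^ (2 * k + 5)) ^ (k + 1))) := by
      simp only [map_add, map_mul, map_pow]
      ring
    rw [e]
    exact dvd_sub hdiv (dvd_add (d1.mul_left _) (d2.mul_left _))
  obtain ⟨h1, h2⟩ := eq_zero_of_X_pow_dvd_affine_pow K (c ^ (k + 2) + a ^ (3 * (k + 2)) * (b - a) ^ ((k + 2) * k))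
    (((b - a) ^ (k + 2) + a ^ (2 * k + 5)) ^ (k + 1)) (b - a) k hr
  exact ⟨pow_eq_zero_iff (Nat.succ_ne_zero k) |>.mp h1, h2⟩

/-- **The order-`p` locus of `g_p` is the origin**: if `g_p(P + v) ∈ (v)^p` then `P = 0` (every field `K` of characteristic
`p = k+2`). [folklore] -/
theorem surfAllP_topLocus (a b c : K)
    (h : MvPolynomial.aeval (fun i => C ((![a, b, c] : Fin 3 → K) i) + X i)
      (X 2 ^ (k + 2) + ((X 0 ^ 3 * (X 1 - X 0) ^ k) ^ (k + 2) +
        (X 1 - X 0) ^ (k + 1) * ((X 1 - X 0) ^ (k + 2) + X 0 ^ (2 * k + 5)) ^ (k + 1)) : MvPolynomial (Fin 3) K) ∈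
        idealOfVars (Fin 3) K ^ (k + 2)) :
    a = 0 ∧ b = 0 ∧ c = 0 := by
  classical
  obtain ⟨hF, hc⟩ := surfAllP_top_step1 K k a b c h
  -- the substitution `v ↦ (t, t, 0)`
  have hφ : ∀ i, Polynomial.X ∣
      (MvPolynomial.aeval ![(Polynomial.X : Polynomial K), Polynomial.X, 0]) (X i : MvPolynomial (Fin 3) K) := by
    intro i
    fin_cases i
    · exact ⟨1, by simp⟩
    · exact ⟨1, by simp⟩
    · exact ⟨0, by simp⟩
  have hdiv := X_pow_dvd_of_mem_pow_idealOfVars K _ hφ (k + 2) h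
  have hcomp : (MvPolynomial.aeval ![(Polynomial.X : Polynomial K), Polynomial.X, 0]) (MvPolynomial.aeval
      (fun i => C ((![a, b, c] : Fin 3 → K) i) + X i)
      (X 2 ^ (k + 2) + ((X 0 ^ 3 * (X 1 - X 0) ^ k) ^ (k + 2) +
        (X 1 - X 0) ^ (k + 1) * ((X 1 - X 0) ^ (k + 2) + X 0 ^ (2 * k + 5)) ^ (k + 1)) : MvPolynomial (Fin 3) K)) =
      Polynomial.C c ^ (k + 2) + (((Polynomial.C a + Polynomial.X) ^ 3 * Polynomial.C (b - a) ^ k) ^ (k + 2) +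
        Polynomial.C (b - a) ^ (k + 1) *
          (Polynomial.C (b - a) ^ (k + 2) + (Polynomial.C a + Polynomial.X) ^ (2 * k + 5)) ^ (k + 1)) := by
    rw [MvPolynomial.comp_aeval_apply]
    simp only [map_add, map_sub, map_mul, map_pow, MvPolynomial.aeval_X, MvPolynomial.aeval_C,
      Polynomial.algebraMap_eq, Matrix.cons_val_zero, Matrix.cons_val_one, Matrix.cons_val_two, Matrix.tail_cons,
      Matrix.head_cons]
    ring
  rw [hcomp] at hdiv
  have hA : (Polynomial.C a + Polynomial.X) ^ (k + 2) = Polynomial.C a ^ (k + 2) + Polynomial.X ^ (k + 2) :=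
    add_pow_char _ _ (k + 2)
  have d1 : (Polynomial.X : Polynomial K) ^ (k + 2) ∣
      ((Polynomial.C a + Polynomial.X) ^ 3 * Polynomial.C (b - a) ^ k) ^ (k + 2) -
        (Polynomial.C a ^ 3 * Polynomial.C (b - a) ^ k) ^ (k + 2) := by
    rw [← sub_pow_char]
    exact pow_dvd_pow_of_dvd (Dvd.intro ((3 * Polynomial.C a ^ 2 + 3 * Polynomial.C a * Polynomial.X + Polynomial.X ^ 2) *
      Polynomial.C (b - a) ^ k) (by ring)) (k + 2)
  have d2 : (Polynomial.X : Polynomial K) ^ (k + 2) ∣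
      (Polynomial.C (b - a) ^ (k + 2) + (Polynomial.C a + Polynomial.X) ^ (2 * k + 5)) ^ (k + 1) -
        (Polynomial.C (b - a) ^ (k + 2) + Polynomial.C a ^ (2 * k + 5) + Polynomial.C a ^ (2 * k + 4) * Polynomial.X) ^
          (k + 1) := by
    refine dvd_trans ?_ (sub_dvd_pow_sub_pow _ _ (k + 1))
    have e25 : (Polynomial.C a + Polynomial.X) ^ (2 * k + 5) =
        (Polynomial.C a ^ (k + 2) + Polynomial.X ^ (k + 2)) ^ 2 * (Polynomial.C a + Polynomial.X) := by
      rw [← hA, ← pow_mul, ← pow_succ]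
      congr 1
      ring
    rw [e25]
    exact Dvd.intro ((2 * Polynomial.C a ^ (k + 2) + Polynomial.X ^ (k + 2)) * (Polynomial.C a + Polynomial.X)) (by ring)
  have hF' : (Polynomial.C (b - a) : Polynomial K) ^ (k + 2) + Polynomial.C a ^ (2 * k + 5) = 0 := by
    rw [← map_pow, ← map_pow, ← map_add, hF, map_zero]
  have hc2 : c ^ (k + 2) + (a ^ 3 * (b - a) ^ k) ^ (k + 2) = 0 := by
    rw [mul_pow, ← pow_mul, ← pow_mul, mul_comm k (k + 2)]
    exact hc
  have hc' : (Polynomial.C c : Polynomial K) ^ (k + 2) + (Polynomial.C a ^ 3 * Polynomial.C (b - a) ^ k) ^ (k + 2) = 0 := by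
    rw [← map_pow, ← map_pow, ← map_pow, ← map_mul, ← map_pow, ← map_add, hc2, map_zero]
  have hr : (Polynomial.X : Polynomial K) ^ (k + 2) ∣
      Polynomial.C ((b - a) ^ (k + 1) * (a ^ (2 * k + 4)) ^ (k + 1)) * Polynomial.X ^ (k + 1) := by
    have e : Polynomial.C ((b - a) ^ (k + 1) * (a ^ (2 * k + 4)) ^ (k + 1)) * Polynomial.X ^ (k + 1) =
        (Polynomial.C c ^ (k + 2) + (((Polynomial.C a + Polynomial.X) ^ 3 * Polynomial.C (b - a) ^ k) ^ (k + 2) +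
          Polynomial.C (b - a) ^ (k + 1) *
            (Polynomial.C (b - a) ^ (k + 2) + (Polynomial.C a + Polynomial.X) ^ (2 * k + 5)) ^ (k + 1))) -
        ((((Polynomial.C a + Polynomial.X) ^ 3 * Polynomial.C (b - a) ^ k) ^ (k + 2) -
            (Polynomial.C a ^ 3 * Polynomial.C (b - a) ^ k) ^ (k + 2)) +
          Polynomial.C (b - a) ^ (k + 1) *
            ((Polynomial.C (b - a) ^ (k + 2) + (Polynomial.C a + Polynomial.X) ^ (2 * k + 5)) ^ (k + 1) -
              (Polynomial.C (b - a) ^ (k + 2) + Polynomial.C a ^ (2 * k + 5) + Polynomial.C a ^ (2 * k + 4) * Polynomial.X) ^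
                (k + 1))) := by
      simp only [map_mul, map_pow]
      rw [hF', zero_add]
      linear_combination (-1 : Polynomial K) * hc'
    rw [e]
    exact dvd_sub hdiv (dvd_add d1 (d2.mul_left _))
  rw [Polynomial.X_pow_dvd_iff] at hr
  have hk := hr (k + 1) (Nat.lt_succ_self _)
  rw [Polynomial.coeff_C_mul_X_pow, if_pos rfl] at hk
  -- `λ^{k+1}·a^{(2k+4)(k+1)} = 0`
  have hla : b - a = 0 ∨ a = 0 := by
    rcases mul_eq_zero.mp hk with h1 | h1
    · exact Or.inl (pow_eq_zero_iff (Nat.succ_ne_zero k) |>.mp h1)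
    · exact Or.inr (pow_eq_zero_iff (by positivity) |>.mp (pow_eq_zero_iff (Nat.succ_ne_zero k) |>.mp h1))
  have ha : a = 0 := by
    rcases hla with h1 | h1
    · rw [h1, zero_pow (Nat.succ_ne_zero _), zero_add] at hF
      exact pow_eq_zero_iff (by omega) |>.mp hF
    · exact h1
  have hb : b = 0 := by
    rw [ha, zero_pow (by omega), add_zero, sub_zero] at hF
    exact pow_eq_zero_iff (Nat.succ_ne_zero _) |>.mp hF
  refine ⟨ha, hb, ?_⟩
  rw [ha, zero_pow (by omega), zero_mul, add_zero] at hc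
  exact pow_eq_zero_iff (Nat.succ_ne_zero _) |>.mp hc

omit hp [CharP K (k + 2)] in
/-- … and the origin does lie in it (`ord₀ g_p = p`): `g_p ∈ (x, y, u)^p`. [folklore] -/
theorem surfAllP_origin_mem_topLocus :
    MvPolynomial.aeval (fun i => C ((![0, 0, 0] : Fin 3 → K) i) + X i)
      (X 2 ^ (k + 2) + ((X 0 ^ 3 * (X 1 - X 0) ^ k) ^ (k + 2) +
        (X 1 - X 0) ^ (k + 1) * ((X 1 - X 0) ^ (k + 2) + X 0 ^ (2 * k + 5)) ^ (k + 1)) : MvPolynomial (Fin 3) K) ∈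
        idealOfVars (Fin 3) K ^ (k + 2) := by
  classical
  have h0 : (fun i => C ((![0, 0, 0] : Fin 3 → K) i) + X i) = fun i => (X i : MvPolynomial (Fin 3) K) := by
    funext i
    fin_cases i <;> simp
  rw [h0, MvPolynomial.aeval_X_left_apply]
  have hX : ∀ i : Fin 3, (X i : MvPolynomial (Fin 3) K) ∈ idealOfVars (Fin 3) K :=
    fun i => Ideal.subset_span (Set.mem_range_self i)
  have hL : (X 1 - X 0 : MvPolynomial (Fin 3) K) ∈ idealOfVars (Fin 3) K := Ideal.sub_mem _ (hX 1) (hX 0)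
  refine Ideal.add_mem _ (Ideal.pow_mem_pow (hX 2) _) (Ideal.add_mem _ ?_ ?_)
  · exact Ideal.pow_mem_pow (Ideal.mul_mem_right _ _ (Ideal.pow_mem_of_mem _ (hX 0) 3 (by norm_num))) _
  · have hF : ((X 1 - X 0) ^ (k + 2) + X 0 ^ (2 * k + 5) : MvPolynomial (Fin 3) K) ∈ idealOfVars (Fin 3) K :=
      Ideal.add_mem _ (Ideal.pow_mem_of_mem _ hL _ (by omega)) (Ideal.pow_mem_of_mem _ (hX 0) _ (by omega))
    have h := Ideal.mul_mem_mul (Ideal.pow_mem_pow hL (k + 1)) (Ideal.pow_mem_of_mem _ hF (k + 1) (by omega))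
    rwa [← pow_succ] at h

/-- **`top(g_p, p) = {0}`** as an iff, every field of characteristic `p = k + 2`. [folklore] -/
theorem surfAllP_topLocus_iff (a b c : K) :
    MvPolynomial.aeval (fun i => C ((![a, b, c] : Fin 3 → K) i) + X i)
      (X 2 ^ (k + 2) + ((X 0 ^ 3 * (X 1 - X 0) ^ k) ^ (k + 2) +
        (X 1 - X 0) ^ (k + 1) * ((X 1 - X 0) ^ (k + 2) + X 0 ^ (2 * k + 5)) ^ (k + 1)) : MvPolynomial (Fin 3) K) ∈
        idealOfVars (Fin 3) K ^ (k + 2) ↔ a = 0 ∧ b = 0 ∧ c = 0 := by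
  refine ⟨surfAllP_topLocus K k a b c, ?_⟩
  rintro ⟨rfl, rfl, rfl⟩
  exact surfAllP_origin_mem_topLocus K k

end Top

end Summit.ResolutionOfSingularities.ResolutionOfSingularities.Theorems.Campaign.W13

end
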